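import Summits.Ventures.LatticeQCDFlow.Scaling.TaggedDeficitStarCover
import Summits.Ventures.LatticeQCDFlow.Scaling.TaggedStartContentResidualG
import Summits.Ventures.LatticeQCDFlow.Scaling.TaggedLoneBetweenBudgetSharp

/-!
HONEST FRAMING: exact (Metropolis-corrected) sampling algorithms for lattice gauge theory; figures
of merit are autocorrelation/cost numbers at stated couplings and volumes; no continuum-physics
claim.

# TaggedDeficitStarCoverBetween — `D_J ≤ (K/(K²−1))·x̃(★)` FOR A HUB STRICTLY BETWEEN THE EXTRA PARTICLES (`W_b ≤ W_z < W_a`), WITH OR WITHOUT A THIRD PARTICLE AT OR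
# ABOVE IT, EVERY `K ≥ 2`: THE CHAIN THROUGH THE TAG POSITION AT `W_z` (lean-2 GEN-43, ours)

Venture-side (OURS).  Cell `lqcd-flow` (pub-lqcd), unit `pub-lqcd-lean-2-g43`, 2026-08-31.  Chapter AC, file 12 — the two remaining configurations of file 11's discounted weak
Σ, both through the intermediate tagged chain `P_Z` with tag content `z` (chapter AB files 12 and 16's construction verbatim):

* **`tagged_deficit_le_star_between`** (a third particle at or above `W_z`): the lower half-move `(Z,Y)` has no deficit (AB file 9 (i)), so `D^{XY}_J ≤ D^{XZ}_J`, and `(X,Z)` is the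
  deep configuration with `b := z` (file 11);
* **`tagged_deficit_le_star_loneBetween`** (`N_C(z) = 1`, every other present content strictly below `W_z`): the signed decomposition of AC file 2 (AB file 15's residual `g`-form for
  `(X,Z)`, AB file 9's hub-above bound for `(Z,Y)`) and file 1's sharp budget `B* = (1−σ)(α/(1+α))σc²[1/(1−σ²c²) − α²/(1+σcα)] ≤ (1−σ)α·c·(c/(1−c²))`.

With file 11: `D_J ≤ (K/(K²−1))·x̃(★)` on every adjacent edge from every ordinary hub for every `K ≥ 2` (file 13).  Literature grade (cell rule): OWN; nothing cited; no new bib keys.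
-/

open Finset

namespace Summit.Ventures.LatticeQCDFlow.Scaling

section CoverBetween
variable {S : Type*} [Fintype S] [DecidableEq S]
variable {W : S → ℝ} {acc : S → S → ℝ} {K : ℕ} {NC : S → ℕ} {a b : S} {PX PY : Option S → Option S → ℝ}

/-- **`D_J ≤ (K/(K²−1))·x̃(★)` FOR A HUB WITH `W_b ≤ W_z < W_a` AND A THIRD PARTICLE AT OR ABOVE `W_z`.** [ours] -/
theorem tagged_deficit_le_star_between (hW : ∀ v, 0 < W v) (hacc : ∀ h v, acc h v = min 1 (W h / W v)) (hK : 2 ≤ K) (hNC : ∑ v, NC v = K)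
    (hPXoff : ∀ h v, h ≠ v → PX (some h) (some v) = if NC h = 0 then 0 else (NC v : ℝ) / K * acc h v)
    (hPXin : ∀ h, PX (some h) none = if NC h = 0 then 0 else acc h a / K)
    (hPXdiag : ∀ h, PX (some h) (some h) = 1 - (∑ v ∈ univ.erase h, PX (some h) (some v) + PX (some h) none))
    (hPXout : ∀ v, PX none (some v) = (NC v : ℝ) / K * acc a v) (hPXstay : PX none none = 1 - ∑ v, PX none (some v))
    (hPYoff : ∀ h v, h ≠ v → PY (some h) (some v) = if NC h = 0 then 0 else (NC v : ℝ) / K * acc h v)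
    (hPYin : ∀ h, PY (some h) none = if NC h = 0 then 0 else acc h b / K)
    (hPYdiag : ∀ h, PY (some h) (some h) = 1 - (∑ v ∈ univ.erase h, PY (some h) (some v) + PY (some h) none))
    (hPYout : ∀ v, PY none (some v) = (NC v : ℝ) / K * acc b v) (hPYstay : PY none none = 1 - ∑ v, PY none (some v))
    {z : S} (hz : NC z ≠ 0) (hbz : W b ≤ W z) (hza : W z < W a) (hthree : 2 ≤ NC z ∨ ∃ w, w ≠ z ∧ NC w ≠ 0 ∧ W z ≤ W w)
    {x y : ℕ → Option S → ℝ}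
    (hx0 : ∀ v, x 0 v = if v = some z then 1 else 0) (hxs : ∀ n v, x (n + 1) v = ∑ h, x n h * PX h v)
    (hy0 : ∀ v, y 0 v = if v = some z then 1 else 0) (hys : ∀ n v, y (n + 1) v = ∑ h, y n h * PY h v)
    {σ : ℝ} (hσ0 : 0 ≤ σ) (hσ1 : σ < 1) {xt : Option S → ℝ} (hxt : ∀ t, xt t = (1 - σ) * PX (some z) t + σ * ∑ t', xt t' * PX t' t) (J : ℕ) :
    ∑ n ∈ range J, (1 - σ) * σ ^ n * max 0 (y (n + 1) (some z) - x (n + 1) (some z)) ≤ (K : ℝ) / ((K : ℝ) ^ 2 - 1) * xt none := by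
  have hK1 : 1 ≤ K := by omega
  -- the intermediate tagged chain `P_Z` (tag content `z`) and its laws `ζ_n` (verbatim from chapter AB file 12)
  classical
  obtain ⟨offZ, hoffZ⟩ : ∃ off : S → S → ℝ, ∀ h v, off h v = if NC h = 0 then 0 else (NC v : ℝ) / K * acc h v := ⟨_, fun _ _ => rfl⟩
  obtain ⟨inZ, hinZ⟩ : ∃ f : S → ℝ, ∀ h, f h = if NC h = 0 then 0 else acc h z / K := ⟨_, fun _ => rfl⟩
  obtain ⟨outZ, houtZ⟩ : ∃ f : S → ℝ, ∀ v, f v = (NC v : ℝ) / K * acc z v := ⟨_, fun _ => rfl⟩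
  obtain ⟨PZ, hPZ⟩ : ∃ PZ : Option S → Option S → ℝ, ∀ s t, PZ s t =
      Option.elim s (Option.elim t (1 - ∑ v, outZ v) (fun v => outZ v))
        (fun h => Option.elim t (inZ h) (fun v => if h = v then 1 - (∑ v' ∈ univ.erase h, offZ h v' + inZ h) else offZ h v)) := ⟨_, fun _ _ => rfl⟩
  have hPZoff : ∀ h v, h ≠ v → PZ (some h) (some v) = if NC h = 0 then 0 else (NC v : ℝ) / K * acc h v := fun h v hhv => by
    rw [hPZ]; simp only [Option.elim]; rw [if_neg hhv, hoffZ]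
  have hPZin : ∀ h, PZ (some h) none = if NC h = 0 then 0 else acc h z / K := fun h => by rw [hPZ]; simp only [Option.elim]; rw [hinZ]
  have hPZdiag : ∀ h, PZ (some h) (some h) = 1 - (∑ v ∈ univ.erase h, PZ (some h) (some v) + PZ (some h) none) := fun h => by
    rw [hPZ]; simp only [Option.elim, if_true]; rw [hPZin, hinZ]
    congr 2
    exact sum_congr rfl fun v hv => by rw [hPZoff h v (ne_of_mem_erase hv).symm, hoffZ]
  have hPZout : ∀ v, PZ none (some v) = (NC v : ℝ) / K * acc z v := fun v => by rw [hPZ]; simp only [Option.elim]; rw [houtZ]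
  have hPZstay : PZ none none = 1 - ∑ v, PZ none (some v) := by
    rw [hPZ]; simp only [Option.elim]; congr 1; exact sum_congr rfl fun v _ => by rw [hPZout, houtZ]
  let ζ : ℕ → Option S → ℝ := fun n => Nat.rec (motive := fun _ => Option S → ℝ) (fun v => if v = some z then 1 else 0) (fun _ prev v => ∑ h, prev h * PZ h v) n
  have hζ0 : ∀ v, ζ 0 v = if v = some z then 1 else 0 := fun _ => rfl
  have hζs : ∀ n v, ζ (n + 1) v = ∑ h, ζ n h * PZ h v := fun _ _ => rfl
  -- the lower half-move `(Z,Y)`: no deficit (AB file 9 (i))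
  obtain ⟨hCZY, -, -, -⟩ := tagged_startClass_above_global hW hacc hK hNC hbz hPZoff hPZin hPZdiag hPZout hPZstay hPYoff hPYin hPYdiag hPYout hPYstay
    hz le_rfl hζ0 hζs hy0 hys (a := z)
  have hno : ∀ n, y n (some z) ≤ ζ n (some z) := hCZY hthree
  -- the upper half-move `(X,Z)`: the deep configuration with `b := z` (file 11)
  have hXZ := tagged_deficit_le_star_deep hW hacc hK hNC hza.le hPXoff hPXin hPXdiag hPXout hPXstay hPZoff hPZin hPZdiag hPZout hPZstay
    hz le_rfl hza hthree hx0 hxs hζ0 hζs hσ0 hσ1 hxt J (b := z)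
  have hDle : ∑ n ∈ range J, (1 - σ) * σ ^ n * max 0 (y (n + 1) (some z) - x (n + 1) (some z))
      ≤ ∑ n ∈ range J, (1 - σ) * σ ^ n * max 0 (ζ (n + 1) (some z) - x (n + 1) (some z)) := by
    refine sum_le_sum fun n _ => mul_le_mul_of_nonneg_left ?_ (mul_nonneg (by linarith) (pow_nonneg hσ0 n))
    exact max_le_max le_rfl (by linarith [hno (n + 1)])
  exact hDle.trans hXZ

/-- **`D_J ≤ (K/(K²−1))·x̃(★)` FOR THE LONE HUB STRICTLY BETWEEN THE EXTRA PARTICLES** (`N_C(z) = 1`, every other present content strictly below `W_z`). [ours] -/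
theorem tagged_deficit_le_star_loneBetween (hW : ∀ v, 0 < W v) (hacc : ∀ h v, acc h v = min 1 (W h / W v)) (hK : 2 ≤ K) (hNC : ∑ v, NC v = K)
    (hPXoff : ∀ h v, h ≠ v → PX (some h) (some v) = if NC h = 0 then 0 else (NC v : ℝ) / K * acc h v)
    (hPXin : ∀ h, PX (some h) none = if NC h = 0 then 0 else acc h a / K)
    (hPXdiag : ∀ h, PX (some h) (some h) = 1 - (∑ v ∈ univ.erase h, PX (some h) (some v) + PX (some h) none))
    (hPXout : ∀ v, PX none (some v) = (NC v : ℝ) / K * acc a v) (hPXstay : PX none none = 1 - ∑ v, PX none (some v))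
    (hPYoff : ∀ h v, h ≠ v → PY (some h) (some v) = if NC h = 0 then 0 else (NC v : ℝ) / K * acc h v)
    (hPYin : ∀ h, PY (some h) none = if NC h = 0 then 0 else acc h b / K)
    (hPYdiag : ∀ h, PY (some h) (some h) = 1 - (∑ v ∈ univ.erase h, PY (some h) (some v) + PY (some h) none))
    (hPYout : ∀ v, PY none (some v) = (NC v : ℝ) / K * acc b v) (hPYstay : PY none none = 1 - ∑ v, PY none (some v))
    {z : S} (hz1 : NC z = 1) (hbz : W b ≤ W z) (hza : W z < W a) (hbelow : ∀ w, w ≠ z → NC w ≠ 0 → W w < W z)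
    {x y : ℕ → Option S → ℝ}
    (hx0 : ∀ v, x 0 v = if v = some z then 1 else 0) (hxs : ∀ n v, x (n + 1) v = ∑ h, x n h * PX h v)
    (hy0 : ∀ v, y 0 v = if v = some z then 1 else 0) (hys : ∀ n v, y (n + 1) v = ∑ h, y n h * PY h v)
    {σ : ℝ} (hσ0 : 0 ≤ σ) (hσ1 : σ < 1) {xt : Option S → ℝ} (hxt : ∀ t, xt t = (1 - σ) * PX (some z) t + σ * ∑ t', xt t' * PX t' t) (J : ℕ) :
    ∑ n ∈ range J, (1 - σ) * σ ^ n * max 0 (y (n + 1) (some z) - x (n + 1) (some z)) ≤ (K : ℝ) / ((K : ℝ) ^ 2 - 1) * xt none := by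
  have hz : NC z ≠ 0 := by rw [hz1]; exact one_ne_zero
  have hK1 : 1 ≤ K := by omega
  have hK0 : (0 : ℝ) < K := by exact_mod_cast (show 0 < K by omega)
  have hK2r : (2 : ℝ) ≤ K := by exact_mod_cast hK
  -- the intermediate tagged chain `P_Z` (tag content `z`) and its laws `ζ_n` (verbatim from chapter AB file 12)
  classical
  obtain ⟨offZ, hoffZ⟩ : ∃ off : S → S → ℝ, ∀ h v, off h v = if NC h = 0 then 0 else (NC v : ℝ) / K * acc h v := ⟨_, fun _ _ => rfl⟩
  obtain ⟨inZ, hinZ⟩ : ∃ f : S → ℝ, ∀ h, f h = if NC h = 0 then 0 else acc h z / K := ⟨_, fun _ => rfl⟩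
  obtain ⟨outZ, houtZ⟩ : ∃ f : S → ℝ, ∀ v, f v = (NC v : ℝ) / K * acc z v := ⟨_, fun _ => rfl⟩
  obtain ⟨PZ, hPZ⟩ : ∃ PZ : Option S → Option S → ℝ, ∀ s t, PZ s t =
      Option.elim s (Option.elim t (1 - ∑ v, outZ v) (fun v => outZ v))
        (fun h => Option.elim t (inZ h) (fun v => if h = v then 1 - (∑ v' ∈ univ.erase h, offZ h v' + inZ h) else offZ h v)) := ⟨_, fun _ _ => rfl⟩
  have hPZoff : ∀ h v, h ≠ v → PZ (some h) (some v) = if NC h = 0 then 0 else (NC v : ℝ) / K * acc h v := fun h v hhv => by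
    rw [hPZ]; simp only [Option.elim]; rw [if_neg hhv, hoffZ]
  have hPZin : ∀ h, PZ (some h) none = if NC h = 0 then 0 else acc h z / K := fun h => by rw [hPZ]; simp only [Option.elim]; rw [hinZ]
  have hPZdiag : ∀ h, PZ (some h) (some h) = 1 - (∑ v ∈ univ.erase h, PZ (some h) (some v) + PZ (some h) none) := fun h => by
    rw [hPZ]; simp only [Option.elim, if_true]; rw [hPZin, hinZ]
    congr 2
    exact sum_congr rfl fun v hv => by rw [hPZoff h v (ne_of_mem_erase hv).symm, hoffZ]
  have hPZout : ∀ v, PZ none (some v) = (NC v : ℝ) / K * acc z v := fun v => by rw [hPZ]; simp only [Option.elim]; rw [houtZ]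
  have hPZstay : PZ none none = 1 - ∑ v, PZ none (some v) := by
    rw [hPZ]; simp only [Option.elim]; congr 1; exact sum_congr rfl fun v _ => by rw [hPZout, houtZ]
  let ζ : ℕ → Option S → ℝ := fun n => Nat.rec (motive := fun _ => Option S → ℝ) (fun v => if v = some z then 1 else 0) (fun _ prev v => ∑ h, prev h * PZ h v) n
  have hζ0 : ∀ v, ζ 0 v = if v = some z then 1 else 0 := fun _ => rfl
  have hζs : ∀ n v, ζ (n + 1) v = ∑ h, ζ n h * PZ h v := fun _ _ => rfl
  -- the two half-moves (AB file 15's signed `g`-form; AB file 9 (ii),(iii))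
  have hg := tagged_startClass_residual_g hW hacc hK hNC hza.le hPXoff hPXin hPXdiag hPXout hPXstay hPZoff hPZin hPZdiag hPZout hPZstay
    hz1 le_rfl hza hbelow hx0 hxs hζ0 hζs (b := z)
  obtain ⟨-, hBzy, hOzy, -⟩ := tagged_startClass_above_global hW hacc hK hNC hbz hPZoff hPZin hPZdiag hPZout hPZstay hPYoff hPYin hPYdiag hPYout hPYstay
    hz le_rfl hζ0 hζs hy0 hys (a := z)
  have hα0 : 0 ≤ W z / W a := div_nonneg (hW z).le (hW a).le
  have hα1 : W z / W a ≤ 1 := (div_le_one (hW a)).mpr hza.le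
  have hc0 : 0 ≤ 1 / (K : ℝ) := by positivity
  have hcK : 1 / (K : ℝ) ≤ 1 / 2 := by rw [div_le_div_iff₀ hK0 (by norm_num)]; linarith
  have hσc : σ * (1 / (K : ℝ)) < 1 := by nlinarith
  have hzz : W z / W z = 1 := div_self (hW z).ne'
  have hg' : ∀ n, ζ n (some z) - x n (some z)
      ≤ (1 / (K : ℝ)) ^ n * ((-(1:ℝ) - (-(1:ℝ)) ^ (n + 1)) / (1 + 1) - (-(W z / W a) - (-(W z / W a)) ^ (n + 1)) / (1 + W z / W a)) := by
    intro n; have h := hg n; rwa [hzz] at h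
  have hB' : ∀ n, y (n + 1) (some z) - ζ (n + 1) (some z) ≤ if Even n then (1 / (K : ℝ)) ^ (n + 1) / 2 else 0 := hBzy
  have hbud := loneBetween_budget_sharp (xz := fun n => x n (some z)) (yz := fun n => y n (some z)) (ζz := fun n => ζ n (some z))
    hα0 hα1 hc0 hσ0 hσ1.le hσc hg' hB' hOzy J
  -- `α = acc(z,a)` and the tail occupation
  have hαeq : acc z a = W z / W a := by rw [hacc]; exact min_eq_right hα1
  have hstar := tagged_star_tail_ge hW hacc hK1 hNC hPXoff hPXin hPXdiag hPXout hPXstay hz hσ0 hσ1 hxt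
  rw [hαeq] at hstar
  have hKK : 0 < (K : ℝ) ^ 2 - 1 := by nlinarith
  -- the scalar: `B*/(1−σ) ≤ α·σc²/(1−σ²c²) ≤ α·c²/(1−c²) = (K/(K²−1))·(α/K)`
  have hσc0 : 0 ≤ σ * (1 / (K : ℝ)) := by positivity
  have hσcK : σ * (1 / (K : ℝ)) ≤ 1 / K := by
    have : σ * (1 / (K : ℝ)) ≤ 1 * (1 / K) := mul_le_mul_of_nonneg_right hσ1.le hc0
    linarith
  have hden : 1 - (1 / (K : ℝ)) ^ 2 ≤ 1 - (σ * (1 / (K : ℝ))) ^ 2 := by nlinarith [pow_le_pow_left₀ hσc0 hσcK 2]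
  have hden1 : 0 < 1 - (1 / (K : ℝ)) ^ 2 := by nlinarith [mul_le_mul hcK hcK hc0 (by norm_num : (0:ℝ) ≤ 1 / 2)]
  have hden0 : 0 < 1 - (σ * (1 / (K : ℝ))) ^ 2 := lt_of_lt_of_le hden1 hden
  have hσcα0 : 0 ≤ σ * (1 / (K : ℝ)) * (W z / W a) := mul_nonneg hσc0 hα0
  have hscal : (W z / W a) / (1 + W z / W a) * (σ * (1 / (K : ℝ)) ^ 2) * (1 / (1 - (σ * (1 / (K : ℝ))) ^ 2) - (W z / W a) ^ 2 / (1 + σ * (1 / (K : ℝ)) * (W z / W a)))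
      ≤ (K : ℝ) / ((K : ℝ) ^ 2 - 1) * ((W z / W a) / K) := by
    have h1 : (W z / W a) / (1 + W z / W a) ≤ W z / W a := div_le_self hα0 (by linarith)
    have h2 : 1 / (1 - (σ * (1 / (K : ℝ))) ^ 2) - (W z / W a) ^ 2 / (1 + σ * (1 / (K : ℝ)) * (W z / W a)) ≤ 1 / (1 - (1 / (K : ℝ)) ^ 2) := by
      have hpos : 0 < 1 + σ * (1 / (K : ℝ)) * (W z / W a) := add_pos_of_pos_of_nonneg one_pos hσcα0
      have h3 : 0 ≤ (W z / W a) ^ 2 / (1 + σ * (1 / (K : ℝ)) * (W z / W a)) := div_nonneg (pow_nonneg hα0 2) hpos.le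
      have h4 : 1 / (1 - (σ * (1 / (K : ℝ))) ^ 2) ≤ 1 / (1 - (1 / (K : ℝ)) ^ 2) := one_div_le_one_div_of_le hden1 hden
      linarith only [h3, h4]
    have h2' : 0 ≤ 1 / (1 - (σ * (1 / (K : ℝ))) ^ 2) - (W z / W a) ^ 2 / (1 + σ * (1 / (K : ℝ)) * (W z / W a)) := by
      have hpos : 0 < 1 + σ * (1 / (K : ℝ)) * (W z / W a) := add_pos_of_pos_of_nonneg one_pos hσcα0
      have h5 : 1 ≤ 1 / (1 - (σ * (1 / (K : ℝ))) ^ 2) := by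
        rw [le_div_iff₀ hden0]
        have := sq_nonneg (σ * (1 / (K : ℝ)))
        linarith only [this]
      have h6 : (W z / W a) ^ 2 / (1 + σ * (1 / (K : ℝ)) * (W z / W a)) ≤ 1 := by
        rw [div_le_one hpos]
        have hα2 : (W z / W a) ^ 2 ≤ 1 := pow_le_one₀ hα0 hα1
        linarith only [hα2, hσcα0]
      linarith only [h5, h6]
    have h7 : σ * (1 / (K : ℝ)) ^ 2 ≤ (1 / (K : ℝ)) ^ 2 := by
      have : σ * (1 / (K : ℝ)) ^ 2 ≤ 1 * (1 / (K : ℝ)) ^ 2 := mul_le_mul_of_nonneg_right hσ1.le (by positivity)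
      linarith
    calc (W z / W a) / (1 + W z / W a) * (σ * (1 / (K : ℝ)) ^ 2) * (1 / (1 - (σ * (1 / (K : ℝ))) ^ 2) - (W z / W a) ^ 2 / (1 + σ * (1 / (K : ℝ)) * (W z / W a)))
        ≤ (W z / W a) * (1 / (K : ℝ)) ^ 2 * (1 / (1 - (1 / (K : ℝ)) ^ 2)) :=
          mul_le_mul (mul_le_mul h1 h7 (by positivity) hα0) h2 h2' (by positivity)
      _ = (K : ℝ) / ((K : ℝ) ^ 2 - 1) * ((W z / W a) / K) := by field_simp
  calc ∑ n ∈ range J, (1 - σ) * σ ^ n * max 0 (y (n + 1) (some z) - x (n + 1) (some z))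
      ≤ (1 - σ) * ((W z / W a) / (1 + W z / W a) * (σ * (1 / (K : ℝ)) ^ 2)
          * (1 / (1 - (σ * (1 / (K : ℝ))) ^ 2) - (W z / W a) ^ 2 / (1 + σ * (1 / (K : ℝ)) * (W z / W a)))) := hbud
    _ ≤ (1 - σ) * ((K : ℝ) / ((K : ℝ) ^ 2 - 1) * ((W z / W a) / K)) := mul_le_mul_of_nonneg_left hscal (by linarith)
    _ = (K : ℝ) / ((K : ℝ) ^ 2 - 1) * ((1 - σ) * ((W z / W a) / K)) := by ring
    _ ≤ (K : ℝ) / ((K : ℝ) ^ 2 - 1) * xt none := mul_le_mul_of_nonneg_left hstar (by positivity)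

end CoverBetween

end Summit.Ventures.LatticeQCDFlow.Scaling
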